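import Summits.QuantumFields.YangMills.Theorems.BalabanUVNodesN11HistoryPinnedResidualDefs
import Literature.MathematicalPhysics.QuantumFieldTheory.Balaban1983to89.Node00.Record13SepCoPHChi
import Literature.MathematicalPhysics.QuantumFieldTheory.Balaban1983to89.Node00.Record13ResidualsRChi

/-!
# χ-GENERIC RE-ISSUE (WORK ORDER RC-1 «RE-CENTRE THE RECORD», director-ym №462 (B) ∕ №467 (D)) of `BalabanUVNodesN11HistoryPinnedResidualDefs`

Cell `pub-ymgap` (HUMAN RULING D-0062, Track A), seat `pub-ymgap-dag-n11-d` (N11 [B14] s2; N11-σ campaign, `N11-G44-RC1-REACH-CENSUS.md`).  The CENTRE-TYPED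
declarations of `BalabanUVNodesN11HistoryPinnedResidualDefs` (those whose statement reads the (2.9) cut-off centre through `gOfRecord₁₃ ∕ EOfRecord₁₃ ∕ Provisos₁₃… ∕ T∕SLaw₁₃… ∕
UbgOfRecord₁₃… ∕ WtOfRecord₁₃… ∕ datum∕tower∕coreOfRecord₁₃…`) RE-ISSUED VERBATIM in the β-slot `χ : ChiSlot F N` over [Ax-3b]∕[Ax-3c]∕[Ax-3d]'s χ-generic carriers
(`Node00/Record13Chi` ∕ `Record13CoPHChi` ∕ `Record13SepCoPHChi`): σ = (binder `(χ : ChiSlot F N)` after `θ`; Node00 defs `X ↦ XChi … χ`; Node00 rows `Y ↦ Y_chi`;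
this lane's sibling modules `…Chi` for Summits-side dependencies); SAME short names in the sibling namespace `…BalabanUVNodesN11HistoryPinnedResidualDefsChi` (consumers switch by namespace);
the 8 centre-FREE declarations of the original are NOT copied — they are reused BY NAME (`open … (…)` below).  At `χ := chiβOfRecord₁₃ θ` every statement here is
DEFINITIONALLY the landed one ([Ax-3b]'s `rfl` receipts); at `χ := chiβOfRecord₁₃Ax θ` it is what the Ax-record's N11 machine reads.  Nothing of record edited (body-freeze №460 (2)).

HONEST FRAMING.  Count-neutral kernel re-elaboration of landed N11 bookkeeping∕estimates in a parameter; every HYPOTHESIS of the original stays a hypothesis; nothing of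
Bałaban asserted beyond what the original file proves; N11 NOT discharged; K-items untouched; counts unmoved.  One finite `𝕋⁴_{L^K}` programme at fixed `ε = L^{−K}` —
NOT ℝ⁴, NOT OS, NOT a mass gap, NOT Clay.  No `sorry`∕`instance`∕`notation`.  Sources: as the original module, plus [I] = [Balaban1987RG1] (2.9) p.266 (the cut-off's centre).
-/

noncomputable section

open MeasureTheory
open scoped BigOperators Matrix.Norms.L2Operator

namespace Summit.QuantumFields.YangMills.Theorems.BalabanUVNodesN11HistoryPinnedResidualDefsChi

open Summit.QuantumFields.YangMills.Theorems.BalabanUVNodesN11HistoryPinnedResidualDefs (truncWindow truncWindow_of_mem truncWindow_of_not restrict_Ω_eq_truncWindow restrict_Λ_eq_truncWindow truncWindow_Ω_self truncWindow_Λ_self truncWindow_truncWindow_of_le)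
open Literature.MathematicalPhysics.QuantumFieldTheory.Balaban1983to89 T4Continuum Node00 Node00.Tk
open B14.Eq218Concrete B15DeterminingSets

variable {F : T4Family} {N : ℕ} [NeZero N]

/-! ## §1  Window truncation of raw set-sequences -/

section Trunc

variable {α : Type*}

end Trunc

/-! ## §2  The generation-`j` pin value of a history and the no-expansion histories with prescribed raw sets -/

section PinValue

variable (θ : Stage13Params F N) (χ : ChiSlot F N) (p : B12.RunParams)

/-- **THE GENERATION-`j` PIN VALUE OF THE HISTORY `s`** (length `j+1`), on the scale-`j` averaging graph: `ω ↦ χ_j(Ω_j(init s))(V_j) · w_j(s)(V_j, V̄_j)` —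
the OLD front factor `χ_j` of the history's first `j` pairs times def-T's resummed 𝐓-step weight of the history at level `j`, read at `V_j = (ω j).1` and its
one-step average of record.  This is the VALUE this seat's general-history 𝐓-step (p544575 `clause_succ_CoPH_of_Omega_empty_of_pinChi_of_clause`, binder
(V) `hZ`) asks of `ζ0_j(T)` at the two-scale configuration; on the all-large-field diagonal (`χ_j ≡ 1`) it is node00-def-K0a's `stepWeightPinOfRecord₁₃`.
[cite: Balaban1988Convergent, (2.17)–(2.18) p.257, (3.2)–(3.5) pp.264–265, (3.16) p.268, (3.20) p.269, (3.24)–(3.25) p.270, p.267] -/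
def histPinOfRecord₁₃ (j : ℕ) (s : SeqOfRecord F θ.ν θ.τ9.M (gOfRecord₁₃Chi F N θ χ p) p.K (j + 1)) (ω : MultiCfg (F.P p.K) (SU N) (FluctV N)) : ℝ :=
  chiSeqOfRecord F N θ.ν θ.τ9.M (gOfRecord₁₃Chi F N θ χ p) p.K j s.init (ω j).1 *
    wOfRecord₉ F N θ.toStage9Params p (gOfRecord₁₃Chi F N θ χ p) j s (ω j).1 ((avOfRecord F N p.K j).avg (ω j).1)

variable {θ χ p}

/-- **THE PIN VALUE IS LOCAL AT SCALE `j`** (12b's `LocalLaws` shape): it reads `ω j` only. [cite: Balaban1988Convergent, (3.2)–(3.3) p.265, p.267 (bookkeeping)] -/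
theorem histPinOfRecord₁₃_local (j : ℕ) (s : SeqOfRecord F θ.ν θ.τ9.M (gOfRecord₁₃Chi F N θ χ p) p.K (j + 1))
    {ω ω' : MultiCfg (F.P p.K) (SU N) (FluctV N)} (h : ω j = ω' j) :
    histPinOfRecord₁₃ θ χ p j s ω = histPinOfRecord₁₃ θ χ p j s ω' := by
  unfold histPinOfRecord₁₃
  rw [h]

/-- **THE PIN VALUE IS NONNEGATIVE at a no-expansion history** (`Ω_{j+1}(s) = ∅`) under unity of def-T's label residual `ζ`: `0 ≤ χ_j` (a product of
characteristic functions) and `0 ≤ w_j(s)` there (`wOfRecord_nonneg_of_Omega_empty`). [cite: Balaban1988Convergent, (2.17)–(2.18) p.257, (3.2)–(3.3) p.265, (3.16) p.268] -/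
theorem histPinOfRecord₁₃_nonneg (hζu : IsZetaUnity F N θ.ν θ.τ9.M θ.ζ) (j : ℕ) (s : SeqOfRecord F θ.ν θ.τ9.M (gOfRecord₁₃Chi F N θ χ p) p.K (j + 1))
    (hΩ : s.Ω (j + 1) = ∅) (ω : MultiCfg (F.P p.K) (SU N) (FluctV N)) : 0 ≤ histPinOfRecord₁₃ θ χ p j s ω :=
  mul_nonneg (chiSeqOfRecord_nonneg F N θ.ν θ.τ9.M _ p.K j s.init _)
    (wOfRecord_nonneg_of_Omega_empty F N θ.ν θ.τ9.M θ.A₁ p (gOfRecord₁₃Chi F N θ χ p) j hζu s hΩ _ _)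

/-- **THE PIN VALUE IS AT MOST ONE at a no-expansion history** under unity of def-T's label residual `ζ` (`χ_j ≤ 1`, `0 ≤ w_j(s) ≤ 1`).
[cite: Balaban1988Convergent, (2.17)–(2.18) p.257, (3.2)–(3.3) p.265, (3.16) p.268] -/
theorem histPinOfRecord₁₃_le_one (hζu : IsZetaUnity F N θ.ν θ.τ9.M θ.ζ) (j : ℕ) (s : SeqOfRecord F θ.ν θ.τ9.M (gOfRecord₁₃Chi F N θ χ p) p.K (j + 1))
    (hΩ : s.Ω (j + 1) = ∅) (ω : MultiCfg (F.P p.K) (SU N) (FluctV N)) : histPinOfRecord₁₃ θ χ p j s ω ≤ 1 := by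
  unfold histPinOfRecord₁₃
  exact mul_le_one₀ (chiSeqOfRecord_le_one F N θ.ν θ.τ9.M _ p.K j s.init _)
    (wOfRecord_nonneg_of_Omega_empty F N θ.ν θ.τ9.M θ.A₁ p (gOfRecord₁₃Chi F N θ χ p) j hζu s hΩ _ _)
    (wOfRecord_le_one_of_Omega_empty F N θ.ν θ.τ9.M θ.A₁ p (gOfRecord₁₃Chi F N θ χ p) j hζu s hΩ _ _)

/-- **THE PIN VALUE AT g3's TWO-SCALE CONFIGURATION `(V_j, V_{j+1}) = (U, V′)`** is `χ_j(init s)(U) · w_j(s)(U, Ū)` — LITERALLY the right-hand side of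
this seat's binder (V) `hZ`. [cite: Balaban1988Convergent, (2.21) p.258, (3.24)–(3.25) p.270 (bookkeeping)] -/
theorem histPinOfRecord₁₃_pairCfgAt (j : ℕ) (s : SeqOfRecord F θ.ν θ.τ9.M (gOfRecord₁₃Chi F N θ χ p) p.K (j + 1))
    (V' : GaugeField (F.P p.K) (j + 1) (SU N)) (U : GaugeField (F.P p.K) j (SU N)) :
    histPinOfRecord₁₃ θ χ p j s (pairCfgAt (V := FluctV N) j V' U) =
      chiSeqOfRecord F N θ.ν θ.τ9.M (gOfRecord₁₃Chi F N θ χ p) p.K j s.init U *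
        wOfRecord₉ F N θ.toStage9Params p (gOfRecord₁₃Chi F N θ χ p) j s U ((avOfRecord F N p.K j).avg U) := by
  unfold histPinOfRecord₁₃
  rw [pairCfgAt_self]

/-- **THE PIN VALUE AT 11a's TWO-SCALE CONFIGURATION `(V₀, V₁) = (U, V₁)`** (generation `0`; `χ_0 ≡ 1`) is `w(s)(U, Ū)` — the right-hand side of the
level-one binder `hZ` of p540862 `hasSect2FormAtZS_clause_one_CoPH_of_provisos`. [cite: Balaban1988Convergent, (1.11) p.248, (2.21) p.258 (bookkeeping)] -/
theorem histPinOfRecord₁₃_pairCfg (s : SeqOfRecord F θ.ν θ.τ9.M (gOfRecord₁₃Chi F N θ χ p) p.K 1)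
    (V1 : GaugeField (F.P p.K) 1 (SU N)) (Uf : GaugeField (F.P p.K) 0 (SU N)) :
    histPinOfRecord₁₃ θ χ p 0 s (pairCfg (V := FluctV N) V1 Uf) =
      wOfRecord₉ F N θ.toStage9Params p (gOfRecord₁₃Chi F N θ χ p) 0 s Uf ((avOfRecord F N p.K 0).avg Uf) := by
  unfold histPinOfRecord₁₃
  rw [pairCfg_zero, chiSeqOfRecord_zero, one_mul]

/-- **ON THE ALL-LARGE-FIELD DIAGONAL THE PIN VALUE IS node00-def-K0a's** (`χ_j(init s′_{j+1}) ≡ 1`): `histPinOfRecord₁₃ θ χ p j s′_{j+1} = stepWeightPinOfRecord₁₃ θ p j`.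
[cite: Balaban1988Convergent, (1.11) p.248, (2.17)–(2.18) p.257, p.267 (bookkeeping)] -/
theorem histPinOfRecord₁₃_seqAllLarge (j : ℕ) (ω : MultiCfg (F.P p.K) (SU N) (FluctV N)) :
    histPinOfRecord₁₃ θ χ p j (seqAllLargeOfRecord F θ.ν θ.τ9.M (gOfRecord₁₃Chi F N θ χ p) p.K (j + 1)) ω = stepWeightPinOfRecord₁₃Chi F N θ χ p j ω := by
  unfold histPinOfRecord₁₃ stepWeightPinOfRecord₁₃Chi
  have hχ : chiSeqOfRecord F N θ.ν θ.τ9.M (gOfRecord₁₃Chi F N θ χ p) p.K j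
      (seqAllLargeOfRecord F θ.ν θ.τ9.M (gOfRecord₁₃Chi F N θ χ p) p.K (j + 1)).init (ω j).1 = 1 := by
    rcases Nat.eq_zero_or_pos j with rfl | hj
    · exact chiSeqOfRecord_zero F N θ.ν θ.τ9.M _ p.K _ _
    · exact chiSeqOfRecord_eq_one_of_Omega_empty F N θ.ν θ.τ9.M _ p.K j _ (seq_init_Ω_of_le _ le_rfl) _
  rw [hχ, one_mul]

/-- **THE NO-EXPANSION HISTORIES OF LENGTH `j+1` WITH PRESCRIBED RAW SETS** `(Ω, Λ)`: the (2.18) indices `s` of length `j+1` whose set-sequences are the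
window truncations of `(Ω, Λ)` and whose top small-field region is empty (`Ω_{j+1}(s) = ∅` — «no expansion at step `j+1`»).  At most one such `s`
(`Seq.ext'`). [cite: Balaban1988Convergent, (2.1) p.254, (2.18) p.257, (2.22) p.258] -/
structure IsNoExpHistAt (Ω Λ : ℕ → Set (Site (F.P p.K) 0)) (j : ℕ) (s : SeqOfRecord F θ.ν θ.τ9.M (gOfRecord₁₃Chi F N θ χ p) p.K (j + 1)) : Prop where
  /-- the history's `Ω`-sequence is the window truncation of the raw `Ω` -/
  Ω_eq : s.Ω = truncWindow (j + 1) Ω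
  /-- the history's `Λ`-sequence is the window truncation of the raw `Λ` -/
  Λ_eq : s.Λ = truncWindow (j + 1) Λ
  /-- no expansion at the top step: `Ω_{j+1}(s) = ∅` -/
  Ω_top : s.Ω (j + 1) = ∅

/-- Uniqueness: two no-expansion histories with the same prescribed raw sets coincide. [cite: Balaban1988Convergent, (2.18) p.257 (bookkeeping)] -/
theorem IsNoExpHistAt.eq {Ω Λ : ℕ → Set (Site (F.P p.K) 0)} {j : ℕ} {s s' : SeqOfRecord F θ.ν θ.τ9.M (gOfRecord₁₃Chi F N θ χ p) p.K (j + 1)}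
    (h : IsNoExpHistAt (θ := θ) (χ := χ) (p := p) Ω Λ j s) (h' : IsNoExpHistAt (θ := θ) (χ := χ) (p := p) Ω Λ j s') : s = s' :=
  Seq.ext' (h.Ω_eq.trans h'.Ω_eq.symm) (h.Λ_eq.trans h'.Λ_eq.symm)

/-- A history of length `j+1` with `Ω_{j+1} = ∅` IS the no-expansion history at its own raw sets. [cite: Balaban1988Convergent, (2.18) p.257 (bookkeeping)] -/
theorem isNoExpHistAt_self {j : ℕ} (s : SeqOfRecord F θ.ν θ.τ9.M (gOfRecord₁₃Chi F N θ χ p) p.K (j + 1)) (hΩ : s.Ω (j + 1) = ∅) :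
    IsNoExpHistAt (θ := θ) (χ := χ) (p := p) s.Ω s.Λ j s :=
  ⟨(truncWindow_Ω_self s).symm, (truncWindow_Λ_self s).symm, hΩ⟩

/-- The restriction of a longer history to length `j+1`, when `Ω_{j+1} = ∅`, is the no-expansion history at the longer history's raw sets.
[cite: Balaban1988Convergent, (2.1) p.254, (2.18) p.257 (bookkeeping)] -/
theorem isNoExpHistAt_restrict {n j : ℕ} (hj : j + 1 ≤ n) (s : SeqOfRecord F θ.ν θ.τ9.M (gOfRecord₁₃Chi F N θ χ p) p.K n) (hΩ : s.Ω (j + 1) = ∅) :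
    IsNoExpHistAt (θ := θ) (χ := χ) (p := p) s.Ω s.Λ j (s.restrict hj) :=
  ⟨restrict_Ω_eq_truncWindow hj s, restrict_Λ_eq_truncWindow hj s, by rw [Seq.restrict_Ω hj s (Nat.succ_pos j) le_rfl]; exact hΩ⟩

end PinValue

/-! ## §3  ★★★ The history-indexed residual 𝐓-weight family and its three laws -/

section Residual

variable (θ : Stage13Params F N) (χ : ChiSlot F N) (p : B12.RunParams)

open Classical in
/-- **★★★ A HISTORY-INDEXED RESIDUAL 𝐓-WEIGHT FAMILY MEETING THIS SEAT's SPEC AT EVERY NO-EXPANSION HISTORY** (a CERTIFICATE VALUE for the v1.7 field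
`Stage13HParams.Zh p n Ω Λ`; LEVEL-FREE: it does not read `n`).  At a generation `j < K` whose prescribed raw sets `(Ω, Λ)` come from a NO-EXPANSION history
`s` of length `j+1` (`IsNoExpHistAt`: `(s.Ω, s.Λ) =` the window truncations, `Ω_{j+1}(s) = ∅`): `ζ0_j(T) :=` the pin value `χ_j(Ω_j(init s))(V_j)·w_j(s)(V_j, V̄_j)`
(§2), `ζ0_j(∅) := 1 −` it, `ζ0_j(Y) := 0` for every other region label; at every other `(j, Ω, Λ)` (expansion at step `j+1`, inadmissible raw sets, `j ≥ K`)
node00-def-K0a's run-indexed residual of record `ZrOfRecord₁₃ θ p` (so this family EXTENDS the history-blind door value: it differs from it only at the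
generations whose ACTUAL history has no expansion, where it reads that history instead of the all-large one — and AGREES with it along the all-large diagonal,
`ZhPinOfRecord₁₃_ζ0_seqAllLarge`); `quad := 0`.  NOT print's (1.11)∕(3.16)–(3.20) resummation as a formula in `Y` (H3, node00-def-T∕K0a∕K0b, [IV]-body read first per
director-ym LINE №186 (1)); it is the kernel object this seat's binders (P)∕(V)∕`hq`∕`hqloc` ask for, nothing more.
[cite: Balaban1988Convergent, (1.11) p.248, p.257, p.267, (2.20)–(2.22) p.258, (3.16)–(3.20) pp.268–269, (3.23)–(3.25) p.270; Balaban1989LargeFieldI, (0.2)–(0.3) p.176] -/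
def ZhPinOfRecord₁₃ (Ω Λ : ℕ → Set (Site (F.P p.K) 0)) : TkResidualW F N (FluctV N) p.K where
  ζ0 := fun j Y ω =>
    if h : j < p.K ∧ ∃ s : SeqOfRecord F θ.ν θ.τ9.M (gOfRecord₁₃Chi F N θ χ p) p.K (j + 1), IsNoExpHistAt (θ := θ) (χ := χ) (p := p) Ω Λ j s then
      (if Y = Set.univ then histPinOfRecord₁₃ θ χ p j (Classical.choose h.2) ω
        else if Y = ∅ then 1 - histPinOfRecord₁₃ θ χ p j (Classical.choose h.2) ω else 0)
    else (ZrOfRecord₁₃Chi F N θ χ p).ζ0 j Y ω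
  quad := fun _ _ _ => 0

variable {θ χ p}

/-- `quad ≡ 0` (the Gaussian placeholder, as K0a's). [cite: Balaban1988Convergent, (3.23) p.270 (bookkeeping)] -/
@[simp] theorem ZhPinOfRecord₁₃_quad (Ω Λ : ℕ → Set (Site (F.P p.K) 0)) (j : ℕ) (Λ' : Set (Site (F.P p.K) 0)) (ω : MultiCfg (F.P p.K) (SU N) (FluctV N)) :
    (ZhPinOfRecord₁₃ θ χ p Ω Λ).quad j Λ' ω = 0 := rfl

open Classical in
/-- **AT A NO-EXPANSION HISTORY `s` OF LENGTH `j+1` (`j < K`): `ζ0_j(T)` IS THE PIN VALUE OF `s`.** [cite: Balaban1988Convergent, (1.11) p.248, p.267, (3.16) p.268] -/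
theorem ZhPinOfRecord₁₃_ζ0_univ_of_hist {Ω Λ : ℕ → Set (Site (F.P p.K) 0)} {j : ℕ} (hj : j < p.K)
    {s : SeqOfRecord F θ.ν θ.τ9.M (gOfRecord₁₃Chi F N θ χ p) p.K (j + 1)} (hs : IsNoExpHistAt (θ := θ) (χ := χ) (p := p) Ω Λ j s)
    (ω : MultiCfg (F.P p.K) (SU N) (FluctV N)) :
    (ZhPinOfRecord₁₃ θ χ p Ω Λ).ζ0 j Set.univ ω = histPinOfRecord₁₃ θ χ p j s ω := by
  have h : j < p.K ∧ ∃ s : SeqOfRecord F θ.ν θ.τ9.M (gOfRecord₁₃Chi F N θ χ p) p.K (j + 1), IsNoExpHistAt (θ := θ) (χ := χ) (p := p) Ω Λ j s := ⟨hj, s, hs⟩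
  have hc : Classical.choose h.2 = s := (Classical.choose_spec h.2).eq hs
  show (if h : j < p.K ∧ ∃ s : SeqOfRecord F θ.ν θ.τ9.M (gOfRecord₁₃Chi F N θ χ p) p.K (j + 1), IsNoExpHistAt (θ := θ) (χ := χ) (p := p) Ω Λ j s then
      (if (Set.univ : Set (Site (F.P p.K) 0)) = Set.univ then histPinOfRecord₁₃ θ χ p j (Classical.choose h.2) ω
        else if (Set.univ : Set (Site (F.P p.K) 0)) = ∅ then 1 - histPinOfRecord₁₃ θ χ p j (Classical.choose h.2) ω else 0)
    else (ZrOfRecord₁₃Chi F N θ χ p).ζ0 j Set.univ ω) = _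
  rw [dif_pos h, if_pos rfl, hc]

open Classical in
/-- **… and `ζ0_j(∅)` IS ITS COMPLEMENT `1 − ζ0_j(T)`.** [cite: Balaban1988Convergent, (3.16)–(3.20) pp.268–269 (bookkeeping)] -/
theorem ZhPinOfRecord₁₃_ζ0_empty_of_hist {Ω Λ : ℕ → Set (Site (F.P p.K) 0)} {j : ℕ} (hj : j < p.K)
    {s : SeqOfRecord F θ.ν θ.τ9.M (gOfRecord₁₃Chi F N θ χ p) p.K (j + 1)} (hs : IsNoExpHistAt (θ := θ) (χ := χ) (p := p) Ω Λ j s)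
    (ω : MultiCfg (F.P p.K) (SU N) (FluctV N)) :
    (ZhPinOfRecord₁₃ θ χ p Ω Λ).ζ0 j ∅ ω = 1 - histPinOfRecord₁₃ θ χ p j s ω := by
  have h : j < p.K ∧ ∃ s : SeqOfRecord F θ.ν θ.τ9.M (gOfRecord₁₃Chi F N θ χ p) p.K (j + 1), IsNoExpHistAt (θ := θ) (χ := χ) (p := p) Ω Λ j s := ⟨hj, s, hs⟩
  have hc : Classical.choose h.2 = s := (Classical.choose_spec h.2).eq hs
  show (if h : j < p.K ∧ ∃ s : SeqOfRecord F θ.ν θ.τ9.M (gOfRecord₁₃Chi F N θ χ p) p.K (j + 1), IsNoExpHistAt (θ := θ) (χ := χ) (p := p) Ω Λ j s then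
      (if (∅ : Set (Site (F.P p.K) 0)) = Set.univ then histPinOfRecord₁₃ θ χ p j (Classical.choose h.2) ω
        else if (∅ : Set (Site (F.P p.K) 0)) = ∅ then 1 - histPinOfRecord₁₃ θ χ p j (Classical.choose h.2) ω else 0)
    else (ZrOfRecord₁₃Chi F N θ χ p).ζ0 j ∅ ω) = _
  rw [dif_pos h, if_neg (Ne.symm (univ_ne_empty_site (F := F) p.K)), if_pos rfl, hc]

open Classical in
/-- **… and `ζ0_j(Y) = 0` for every other region label** (by fiat, as K0a's). [cite: Balaban1988Convergent, p.267 (bookkeeping)] -/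
theorem ZhPinOfRecord₁₃_ζ0_of_hist_of_ne_of_ne {Ω Λ : ℕ → Set (Site (F.P p.K) 0)} {j : ℕ} (hj : j < p.K)
    {s : SeqOfRecord F θ.ν θ.τ9.M (gOfRecord₁₃Chi F N θ χ p) p.K (j + 1)} (hs : IsNoExpHistAt (θ := θ) (χ := χ) (p := p) Ω Λ j s)
    {Y : Set (Site (F.P p.K) 0)} (hT : Y ≠ Set.univ) (h0 : Y ≠ ∅) (ω : MultiCfg (F.P p.K) (SU N) (FluctV N)) :
    (ZhPinOfRecord₁₃ θ χ p Ω Λ).ζ0 j Y ω = 0 := by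
  have h : j < p.K ∧ ∃ s : SeqOfRecord F θ.ν θ.τ9.M (gOfRecord₁₃Chi F N θ χ p) p.K (j + 1), IsNoExpHistAt (θ := θ) (χ := χ) (p := p) Ω Λ j s := ⟨hj, s, hs⟩
  show (if h : j < p.K ∧ ∃ s : SeqOfRecord F θ.ν θ.τ9.M (gOfRecord₁₃Chi F N θ χ p) p.K (j + 1), IsNoExpHistAt (θ := θ) (χ := χ) (p := p) Ω Λ j s then
      (if Y = Set.univ then histPinOfRecord₁₃ θ χ p j (Classical.choose h.2) ω
        else if Y = ∅ then 1 - histPinOfRecord₁₃ θ χ p j (Classical.choose h.2) ω else 0)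
    else (ZrOfRecord₁₃Chi F N θ χ p).ζ0 j Y ω) = _
  rw [dif_pos h, if_neg hT, if_neg h0]

open Classical in
/-- **OFF THE NO-EXPANSION HISTORIES (or at `j ≥ K`) THE FAMILY IS node00-def-K0a's run-indexed residual of record.** [cite: Balaban1988Convergent, p.267 (bookkeeping)] -/
theorem ZhPinOfRecord₁₃_ζ0_of_not {Ω Λ : ℕ → Set (Site (F.P p.K) 0)} {j : ℕ}
    (h : ¬ (j < p.K ∧ ∃ s : SeqOfRecord F θ.ν θ.τ9.M (gOfRecord₁₃Chi F N θ χ p) p.K (j + 1), IsNoExpHistAt (θ := θ) (χ := χ) (p := p) Ω Λ j s))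
    (Y : Set (Site (F.P p.K) 0)) (ω : MultiCfg (F.P p.K) (SU N) (FluctV N)) :
    (ZhPinOfRecord₁₃ θ χ p Ω Λ).ζ0 j Y ω = (ZrOfRecord₁₃Chi F N θ χ p).ζ0 j Y ω := by
  show (if h : j < p.K ∧ ∃ s : SeqOfRecord F θ.ν θ.τ9.M (gOfRecord₁₃Chi F N θ χ p) p.K (j + 1), IsNoExpHistAt (θ := θ) (χ := χ) (p := p) Ω Λ j s then
      (if Y = Set.univ then histPinOfRecord₁₃ θ χ p j (Classical.choose h.2) ω
        else if Y = ∅ then 1 - histPinOfRecord₁₃ θ χ p j (Classical.choose h.2) ω else 0)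
    else (ZrOfRecord₁₃Chi F N θ χ p).ζ0 j Y ω) = _
  rw [dif_neg h]

/-- **★ 12a's RESIDUAL LAW `ζ0 ≥ 0`** for the history-indexed family (the row `zhLaws` at the re-pinned parameter), under unity of def-T's label residual `θ.ζ`
(the pin value lies in `[0, 1]` at a no-expansion history; K0a's `laws_ZrOfRecord₁₃_chi` elsewhere). [cite: Balaban1988Convergent, p.267, (3.2)–(3.3) p.265, (3.16) p.268] -/
theorem laws_ZhPinOfRecord₁₃ (hζu : IsZetaUnity F N θ.ν θ.τ9.M θ.ζ) (Ω Λ : ℕ → Set (Site (F.P p.K) 0)) : (ZhPinOfRecord₁₃ θ χ p Ω Λ).Laws := by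
  refine ⟨fun j Y ω => ?_⟩
  by_cases h : j < p.K ∧ ∃ s : SeqOfRecord F θ.ν θ.τ9.M (gOfRecord₁₃Chi F N θ χ p) p.K (j + 1), IsNoExpHistAt (θ := θ) (χ := χ) (p := p) Ω Λ j s
  · obtain ⟨hj, s, hs⟩ := h
    by_cases hT : Y = Set.univ
    · subst hT
      rw [ZhPinOfRecord₁₃_ζ0_univ_of_hist hj hs]
      exact histPinOfRecord₁₃_nonneg hζu j s hs.Ω_top ω
    · by_cases h0 : Y = ∅
      · subst h0
        rw [ZhPinOfRecord₁₃_ζ0_empty_of_hist hj hs]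
        exact sub_nonneg.mpr (histPinOfRecord₁₃_le_one hζu j s hs.Ω_top ω)
      · rw [ZhPinOfRecord₁₃_ζ0_of_hist_of_ne_of_ne hj hs hT h0]
  · rw [ZhPinOfRecord₁₃_ζ0_of_not h]
    exact (laws_ZrOfRecord₁₃_chi (θ := θ) (p := p) hζu).zeta0_nonneg j Y ω

/-- **★ 12b's LOCALITY LAW** for the history-indexed family (the row `zhLocal` at the re-pinned parameter): `ζ0_j(Y)` reads the scale-`j` configuration only
(the pin value does, §2; K0a's residual does, `localLaws_ZrOfRecord₁₃_chi`). [cite: Balaban1988Convergent, (3.2)–(3.3) p.265, p.267] -/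
theorem localLaws_ZhPinOfRecord₁₃ (Ω Λ : ℕ → Set (Site (F.P p.K) 0)) : (ZhPinOfRecord₁₃ θ χ p Ω Λ).LocalLaws := by
  -- v1.1 (T0′ of the FLAG №1 R2b cure): introduced through the funnel `LocalLaws.of_oneScale`, so the text survives the in-place weakening of the row
  refine TkResidualW.LocalLaws.of_oneScale (fun j Y ω ω' hω => ?_)
  by_cases h : j < p.K ∧ ∃ s : SeqOfRecord F θ.ν θ.τ9.M (gOfRecord₁₃Chi F N θ χ p) p.K (j + 1), IsNoExpHistAt (θ := θ) (χ := χ) (p := p) Ω Λ j s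
  · obtain ⟨hj, s, hs⟩ := h
    by_cases hT : Y = Set.univ
    · subst hT
      rw [ZhPinOfRecord₁₃_ζ0_univ_of_hist hj hs, ZhPinOfRecord₁₃_ζ0_univ_of_hist hj hs, histPinOfRecord₁₃_local j s hω]
    · by_cases h0 : Y = ∅
      · subst h0
        rw [ZhPinOfRecord₁₃_ζ0_empty_of_hist hj hs, ZhPinOfRecord₁₃_ζ0_empty_of_hist hj hs, histPinOfRecord₁₃_local j s hω]
      · rw [ZhPinOfRecord₁₃_ζ0_of_hist_of_ne_of_ne hj hs hT h0, ZhPinOfRecord₁₃_ζ0_of_hist_of_ne_of_ne hj hs hT h0]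
  · rw [ZhPinOfRecord₁₃_ζ0_of_not h, ZhPinOfRecord₁₃_ζ0_of_not h]
    -- K0a's residual reads scale `j` only (its own one-scale argument, inlined so no law of `ZrOfRecord₁₃` is consumed here)
    by_cases hj : j < p.K
    · simp only [ZrOfRecord₁₃Chi, if_pos hj, stepWeightPinOfRecord₁₃_local_chi j hω]
    · rw [ZrOfRecord₁₃_ζ0_of_le_chi (Nat.not_lt.mp hj), ZrOfRecord₁₃_ζ0_of_le_chi (Nat.not_lt.mp hj)]
      rfl

/-- **★ PRINT'S PARTITION OF UNITY AT EVERY GENERATION** for the history-indexed family (the guard `ZhUnity` at the re-pinned parameter): on a no-expansion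
history `ζ0_j(T) + ζ0_j(∅) = 1`, elsewhere K0a's `finsum_ζ0_ZrOfRecord₁₃_chi`. [cite: Balaban1988Convergent, (3.16)–(3.20) pp.268–269] -/
theorem finsum_ζ0_ZhPinOfRecord₁₃ (Ω Λ : ℕ → Set (Site (F.P p.K) 0)) (j : ℕ) (ω : MultiCfg (F.P p.K) (SU N) (FluctV N)) :
    (∑ᶠ Y : Set (Site (F.P p.K) 0), (ZhPinOfRecord₁₃ θ χ p Ω Λ).ζ0 j Y ω) = 1 := by
  classical
  by_cases h : j < p.K ∧ ∃ s : SeqOfRecord F θ.ν θ.τ9.M (gOfRecord₁₃Chi F N θ χ p) p.K (j + 1), IsNoExpHistAt (θ := θ) (χ := χ) (p := p) Ω Λ j s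
  · obtain ⟨hj, s, hs⟩ := h
    haveI : Fintype (Set (Site (F.P p.K) 0)) := Fintype.ofFinite _
    have hne : (Set.univ : Set (Site (F.P p.K) 0)) ≠ ∅ := univ_ne_empty_site (F := F) p.K
    rw [finsum_eq_sum_of_fintype,
      Finset.sum_eq_add_of_mem (Set.univ : Set (Site (F.P p.K) 0)) ∅ (Finset.mem_univ _) (Finset.mem_univ _) hne]
    · rw [ZhPinOfRecord₁₃_ζ0_univ_of_hist hj hs, ZhPinOfRecord₁₃_ζ0_empty_of_hist hj hs]
      ring
    · intro Y _ hY
      exact ZhPinOfRecord₁₃_ζ0_of_hist_of_ne_of_ne hj hs hY.1 hY.2 ω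
  · rw [show (fun Y : Set (Site (F.P p.K) 0) => (ZhPinOfRecord₁₃ θ χ p Ω Λ).ζ0 j Y ω) = fun Y => (ZrOfRecord₁₃Chi F N θ χ p).ζ0 j Y ω from
      funext fun Y => ZhPinOfRecord₁₃_ζ0_of_not h Y ω]
    exact finsum_ζ0_ZrOfRecord₁₃_chi j ω

/-- **ALONG THE ALL-LARGE-FIELD DIAGONAL THE FAMILY IS node00-def-K0a's RESIDUAL OF RECORD** (value level, every `(j, Y, ω)`): at the raw sets of the all-large
index of any length the no-expansion history at generation `j < K` is `s′_{j+1}` and its pin value is `stepWeightPinOfRecord₁₃` (`χ_j ≡ 1`).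
[cite: Balaban1988Convergent, (1.11) p.248, p.267, (3.16)–(3.20) pp.268–269 (bookkeeping)] -/
theorem ZhPinOfRecord₁₃_ζ0_seqAllLarge (n j : ℕ) (Y : Set (Site (F.P p.K) 0)) (ω : MultiCfg (F.P p.K) (SU N) (FluctV N)) :
    (ZhPinOfRecord₁₃ θ χ p (seqAllLargeOfRecord F θ.ν θ.τ9.M (gOfRecord₁₃Chi F N θ χ p) p.K n).Ω
        (seqAllLargeOfRecord F θ.ν θ.τ9.M (gOfRecord₁₃Chi F N θ χ p) p.K n).Λ).ζ0 j Y ω = (ZrOfRecord₁₃Chi F N θ χ p).ζ0 j Y ω := by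
  by_cases hj : j < p.K
  · -- the no-expansion history at the all-large raw sets is the all-large index of length `j+1`
    have hs : IsNoExpHistAt (θ := θ) (χ := χ) (p := p) (seqAllLargeOfRecord F θ.ν θ.τ9.M (gOfRecord₁₃Chi F N θ χ p) p.K n).Ω
        (seqAllLargeOfRecord F θ.ν θ.τ9.M (gOfRecord₁₃Chi F N θ χ p) p.K n).Λ j
        (seqAllLargeOfRecord F θ.ν θ.τ9.M (gOfRecord₁₃Chi F N θ χ p) p.K (j + 1)) := by
      refine ⟨?_, ?_, rfl⟩
      · funext i
        show (∅ : Set (Site (F.P p.K) 0)) = truncWindow (j + 1) (fun _ => ∅) i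
        unfold truncWindow; split_ifs <;> rfl
      · funext i
        show (∅ : Set (Site (F.P p.K) 0)) = truncWindow (j + 1) (fun _ => ∅) i
        unfold truncWindow; split_ifs <;> rfl
    by_cases hT : Y = Set.univ
    · subst hT
      rw [ZhPinOfRecord₁₃_ζ0_univ_of_hist hj hs, ZrOfRecord₁₃_ζ0_univ_chi hj, histPinOfRecord₁₃_seqAllLarge]
    · by_cases h0 : Y = ∅
      · subst h0
        rw [ZhPinOfRecord₁₃_ζ0_empty_of_hist hj hs, ZrOfRecord₁₃_ζ0_empty_chi hj, histPinOfRecord₁₃_seqAllLarge]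
      · rw [ZhPinOfRecord₁₃_ζ0_of_hist_of_ne_of_ne hj hs hT h0, ZrOfRecord₁₃_ζ0_of_ne_of_ne_chi hj hT h0]
  · exact ZhPinOfRecord₁₃_ζ0_of_not (fun h => hj h.1) Y ω

end Residual

end Summit.QuantumFields.YangMills.Theorems.BalabanUVNodesN11HistoryPinnedResidualDefsChi

end
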